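import Literature.MathematicalPhysics.QuantumFieldTheory.Balaban1983to89.B8SockSP5ProviderSrc
import Literature.MathematicalPhysics.QuantumFieldTheory.Balaban1983to89.B8SockSP5BaseSrc
import Literature.MathematicalPhysics.QuantumFieldTheory.Balaban1983to89.B8SockSP5uProviderSrc
import Literature.MathematicalPhysics.QuantumFieldTheory.Balaban1983to89.B8SockWindowsSrc

/-!
# `Balaban1983to89.B8SockSP5ThresholdsSrc` — [Balaban1985RegularSpaces] Prop. 5 p. 94 ∕ Thm 8 (1.146) p. 101: THE THREE SOURCED PROPOSITION-5 SOCKETS OF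
# THE THEOREM-8 KNIT (`SP5`, `SP5base`, `SP5u` in the E currency) SERVED AT ONE MEMBER BELOW ONE THRESHOLD — the providers
# `B8SockSP5ProviderSrc` ∕ `B8SockSP5BaseSrc` ∕ `B8SockSP5uProviderSrc` with their displayed windows families DISCHARGED by `B8SockWindowsSrc`

statement-level skeleton of published theorems with citation tags; proofs where landed; nothing here is a claim about the Yang–Mills mass gap

T. Bałaban, *Spaces of regular gauge field configurations on a lattice and gauge fixing conditions*, Commun. Math. Phys. **99** (1985) 75–102
`[Balaban1985RegularSpaces]` ("B8"): Prop. 5 (1.106)–(1.110) p. 94 («There exist positive constants c₂, c₃, depending on d and L only …»), Thm 4 p. 88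
(«there exists a constant c₁»), Thm 8 (1.146) p. 101; [4] = [Balaban1985BackgroundPropagators] Thm 3.1 p. 397, Thm 3.3 p. 398.

WHY THIS FILE (cell `pub-ymgap`, HUMAN RULING D-0062; R134 acceleration seat `pub-ymgap-dag-n05-d` (g5) = the PROVIDER of the Proposition-5 sockets of the
Theorem-8 knit in the H currency).  The three providers take a DISPLAYED windows family `hwin` below a free threshold `c_P`; `B8SockWindowsSrc` proves
those families from one threshold (`hfpWindows_of_guard_src` under the free-constant condition with source `3·(2dL²)·B_G·B_R·(B₈ + γ) ≤ B₀′·B₈`;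
`uniqWindows_of_guard_src` with print's `∃ α₄, c_u`).  THIS FILE composes them — **`exists_threshold_sp5_src`**, **`exists_threshold_sp5base_src`**,
**`exists_threshold_sp5u_src`**: GIVEN [4]'s letters below `c_L > 0` (`SockLettersRD`, resp. the guarded uniqueness letters `SLetUB`), the member's sourced
b9 socket `SH59src` below its own threshold `c₅₉ > 0` (not read by `SP5base`), the member laws and the guard, THERE IS `c_P > 0` (resp. `c_u, c_P > 0`) such
that the knit's `SP5` ∕ `SP5base` ∕ ρ3-`SP5u` binder body at `LanF := LanF146` HOLDS at the member for all `α₀ + α₁ ≤ c_P` — print's constants `c₁`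
(Thm 4), `c₂, c₃` (Prop. 5) for the sourced equation (1.146), «depending on d and L only» here through `d, L, B₈, B₀′, γ` and [4]'s displayed constants.

HONEST SCOPE.  Composition only (`c_P := min(c_W, c_L, c₅₉)`); [4]'s letters and the b9 socket stay HYPOTHESES; no estimate of the paper is proved here
beyond the cited modules; constants sufficient, not optimal.  Count-neutral; N05 NOT discharged; one finite T⁴ programme at fixed ε; nothing continuum /
ℝ⁴ / OS / mass-gap / Clay.  No `sorry`, no `def`, no `instance`, no `notation`.  Unit `pub-ymgap-dag-n05-d` (g5), 2026-08-27.
-/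

noncomputable section

open NormedSpace

namespace Literature.MathematicalPhysics.QuantumFieldTheory.Balaban1983to89.B8SockSP5ThresholdsSrc

open Complex (I)
open MatrixLog B7Prop1Explicit B7Prop2Explicit B7Prop1Local B7Eq92Concrete
open B7Prop2Explicit (C0 c2')
open B7Prop3Flat (c3)
open B7Prop10General (C6 C4G)
open B7Prop9Flat (C5')
open B7Eq78Linearization (conjR zdBlocking QprimeIter)
open B8Ineq132 (covDerivFwd covDeriv InAk)
open B8Eq119TwistedAxial (Restr129 InAx bgT)
open B8Eq184Proof (gaugeExp cfgExp)
open B8Lemma1NonAbelian (mulCfg)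
open B8Eq140Level (SideTouches)
open B8Eq146AExpansion (iEta expCfg)
open B8Ineq130 (tlo thi)
open B8Thm2LogB (blockTop)
open B8Eq138LandauZd (InR138 covDivB covLap QT logCfg)
open B8Ineq125Concrete (C2p)
open B8Eq1117Concrete (XSpace)
open B8Eq155JBound (Jcur wsup)
open B7Prop4GeneralLevels (linCovIter)
open B8ScaledSupNorm (bondNorm msup Bdd)
open B8Prop5ContractionKLevel (Bd2 Mc Kc)
open B8LambdaSpaceKLevel (wt)
open B8SockLettersRD (SockLettersRD)
open B8LanF146 (LanF146)
open B8SockSP5ProviderSrc (sp5_of_sockLettersRD_src)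
open B8SockSP5BaseSrc (sp5base_of_sockLettersRD_src)
open B8SockSP5uProviderSrc (sp5uE_of_lettersUB_src)
open B8SockWindowsSrc (hfpWindows_of_guard_src uniqWindows_of_guard_src)
open QuantumLattice (blockSites)

-- `Site` alone could resolve to the torus sites of `Setup.lean`; re-export the `ℤ^d` sites of `B7Prop1Explicit`.
export B7Prop1Explicit (Site)

variable {d : ℕ} {𝔸 : Type*} [CStarAlgebra 𝔸] [Nontrivial 𝔸]
variable {L : ℕ} {η : ℝ} {k : ℕ} {Ω : ℕ → Set (Site d)} {Λs : ℕ → ℕ → Set (Site d)} {Λb : ℕ → ℕ → Set (Site d × Fin d)}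
  {B₀ B₀' B₈ B₀'H B₂' BG BR cL γ γ' : ℝ}

/-- **THE KNIT's SOURCED SOCKET `SP5` AT ONE MEMBER, BELOW ONE THRESHOLD** (Theorem 4's «there exists a constant c₁» for Proposition 5 at Theorem 8's gauge
condition): `B8SockSP5ProviderSrc.sp5_of_sockLettersRD_src` with its windows family discharged by `B8SockWindowsSrc.hfpWindows_of_guard_src`
(`c_P := min(c_W, c_L, c₅₉)`).
[cite: Balaban1985RegularSpaces, Thm 4 p.88 («there exists a constant c₁»), Prop. 5 (1.106)–(1.108) p.94, Thm 8 (1.146) p.101; Balaban1985BackgroundPropagators, Thm 3.1 p.397, Thm 3.3 p.398] -/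
theorem exists_threshold_sp5_src (hd2 : 2 ≤ d) (hL : 2 ≤ L) (hη : 0 < η) (hΩ : ∀ j, Ω (j + 1) ⊆ Ω j)
    (hB8two : 2 ≤ 5 * (d : ℝ) * L * B₈) (hfree : 3 * (2 * (d : ℝ) * (L : ℝ) ^ 2) * BG * BR * (B₈ + γ) ≤ B₀' * B₈) (hcL : 0 < cL)
    (hbox : ∀ m, m ≤ k → ∀ j, j ≤ m → ∀ c ∈ Λb m j, ∀ x, InBox (loK L j c.1) (bondHiK L j c.1 c.2) x → x ∈ Ω j)
    (hclass : ∀ m, m ≤ k → ∀ j, j ≤ m → ∀ c ∈ Λb m j,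
      (c.1 ∈ Λs m j ∧ c.1 + e c.2 ∈ Λs m j) ∨
      (∃ j', j = j' + 1 ∧ (∀ x, (L : ℤ) • c.1 ≤ x → x ≤ (L : ℤ) • c.1 + blockTop L → x ∈ Λs m j') ∧ c.1 + e c.2 ∈ Λs m j) ∨
      (∃ j', j = j' + 1 ∧ c.1 ∈ Λs m j ∧ (∀ x, (L : ℤ) • (c.1 + e c.2) ≤ x → x ≤ (L : ℤ) • (c.1 + e c.2) + blockTop L → x ∈ Λs m j')))
    (htw : ∀ m, m ≤ k → ∀ j, j ≤ m → ∀ y ∈ Λs m j, ∀ x, InBox (tlo L y j) (thi L y j) x → x ∈ Ω j)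
    (h8lt : ∀ m, m < k → ∀ j, j < m → Λs m j = Λs (m + 1) j)
    (h8top : ∀ m, m < k → ∀ x, x ∈ Λs m m ↔ x ∈ Λs (m + 1) m ∨ ∃ y ∈ Λs (m + 1) (m + 1), x ∈ blockSites L y)
    (hB₀ : 0 < B₀) (hB₀' : 0 < B₀') (hB₀'H : 0 < B₀'H) (hB₂' : 0 ≤ B₂') (hBG : 0 ≤ BG) (hBR : 0 ≤ BR) (hγ : 0 ≤ γ) (hγ' : 0 ≤ γ')
    (hB₀8 : B₀ ≤ B₈) (hγB : 2 * (γ' * B₀) ≤ 5 * (d : ℝ) * L * B₈)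
    (SLet : SockLettersRD (𝔸 := 𝔸) L BG BR B₀'H B₂' cL η k Ω Λs)
    -- THE SOURCED b9 SOCKET AT THIS MEMBER (the knit's `SH59src` at `LanF := LanF146`)
    {c59 : ℝ} (hc59 : 0 < c59)
    (SH59 : ∀ α₀ α₁ : ℝ, 0 < α₀ → 0 < α₁ → α₀ + α₁ ≤ c59 →
      ∀ U₀ U' : Site d → Fin d → 𝔸ˣ, (∀ x κ, U₀ x κ ∈ unitaryUnits 𝔸) → (∀ x κ, U' x κ ∈ unitaryUnits 𝔸) →
      ∀ φ : Site d → 𝔸, ((InR138 L k η (Ω 0) (Λs k) U₀ φ ∧ (∀ x, IsSelfAdjoint (φ x)) ∧ (∀ x, x ∉ Ω 0 → φ x = 0) ∧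
          Bdd L k η (-(2 : ℝ)) (fun j (x : Site d) => x ∈ Ω j) φ) ∧
        msup L k η (-(2 : ℝ)) (fun j (x : Site d) => x ∈ Ω j) φ < γ * (α₀ + α₁)) →
      InAk L k η α₀ Ω U₀ → InAk L k η α₀ Ω (mulCfg U' U₀) → (∀ m, m ≤ k → InAx L m (Λs m) U₀ (mulCfg U' U₀)) →
      (∀ j, j ≤ k → ∀ (z : Site d) (μ : Fin d), (∀ x, InBox (loK L j z) (bondHiK L j z μ) x → x ∈ Ω j) →
        ‖(avgIter L (mulCfg U' U₀) j z μ : 𝔸) - (avgIter L U₀ j z μ : 𝔸)‖ ≤ α₁) →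
      (∀ b ∈ {b : Site d × Fin d | SideTouches (Ω 0) b.1 b.2}, ‖((U' b.1 b.2 : 𝔸ˣ) : 𝔸) - 1‖ ≤ α₁) →
      (∀ m, 1 ≤ m → m ≤ k → ∀ (u : Site d → 𝔸ˣ) (W : Site d → Fin d → 𝔸ˣ) (A' : Site d → Fin d → 𝔸),
        (∀ x, u x ∈ unitaryUnits 𝔸) → mgauge U₀ u W = U' → Restr129 L m (Λs m) U₀ u → LanF146 L k η (Ω 0) Λs U₀ φ m W →
        (∀ y τ, IsSelfAdjoint (A' y τ)) →
        (∀ j, j ≤ m → ∀ y τ, SideTouches (Ω j) y τ →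
        W y τ = cfgExp η A' y τ ∧ ‖A' y τ‖ ≤ (2 * (L * (5 * (d : ℝ) * L * B₈ * (α₀ + α₁))) + 8 * (8 * B₀' * (5 * (d : ℝ) * L * B₈) * (α₀ + α₁))) * ((L : ℝ) ^ j * η)⁻¹) →
        (∀ y τ, (∀ j, j ≤ m → ¬ SideTouches (Ω j) y τ) → A' y τ = 0) →
        msup L m η (-(1 : ℝ)) (fun j (b : Site d × Fin d) => SideTouches (Ω j) b.1 b.2) (fun b => A' b.1 b.2)
        ≤ B₀ * (bondNorm L m η (-(3 : ℝ)) Ω (fun x μ => Jcur η U₀ A' μ x)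
        + wsup 1 (fun p : {p : ℕ × (Site d × Fin d) // p.1 ≤ m ∧ p.2 ∈ Λb m p.1} =>
        linCovIter L U₀ (iEta η A') p.1.1 p.1.2.1 p.1.2.2)) + γ' * B₀ * (α₀ + α₁) ∧
        msup L m η (-(2 : ℝ)) (fun j (t : Fin d × Fin d × Site d) => SideTouches (Ω j) t.2.2 t.2.1)
        (fun t => covDerivFwd η U₀ t.1 (fun z => A' z t.2.1) t.2.2)
        ≤ B₀ * (bondNorm L m η (-(3 : ℝ)) Ω (fun x μ => Jcur η U₀ A' μ x)
        + wsup 1 (fun p : {p : ℕ × (Site d × Fin d) // p.1 ≤ m ∧ p.2 ∈ Λb m p.1} =>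
        linCovIter L U₀ (iEta η A') p.1.1 p.1.2.1 p.1.2.2)) + γ' * B₀ * (α₀ + α₁))) :
    ∃ cP : ℝ, 0 < cP ∧
    ∀ α₀ α₁ : ℝ, 0 < α₀ → 0 < α₁ → α₀ + α₁ ≤ cP →
      ∀ U₀ U' : Site d → Fin d → 𝔸ˣ, (∀ x κ, U₀ x κ ∈ unitaryUnits 𝔸) → (∀ x κ, U' x κ ∈ unitaryUnits 𝔸) →
      ∀ φ : Site d → 𝔸, ((InR138 L k η (Ω 0) (Λs k) U₀ φ ∧ (∀ x, IsSelfAdjoint (φ x)) ∧ (∀ x, x ∉ Ω 0 → φ x = 0) ∧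
          Bdd L k η (-(2 : ℝ)) (fun j (x : Site d) => x ∈ Ω j) φ) ∧
        msup L k η (-(2 : ℝ)) (fun j (x : Site d) => x ∈ Ω j) φ < γ * (α₀ + α₁)) →
      InAk L k η α₀ Ω U₀ → InAk L k η α₀ Ω (mulCfg U' U₀) → (∀ m, m ≤ k → InAx L m (Λs m) U₀ (mulCfg U' U₀)) →
      (∀ j, j ≤ k → ∀ (z : Site d) (μ : Fin d), (∀ x, InBox (loK L j z) (bondHiK L j z μ) x → x ∈ Ω j) →
        ‖(avgIter L (mulCfg U' U₀) j z μ : 𝔸) - (avgIter L U₀ j z μ : 𝔸)‖ ≤ α₁) →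
      (∀ b ∈ {b : Site d × Fin d | SideTouches (Ω 0) b.1 b.2}, ‖((U' b.1 b.2 : 𝔸ˣ) : 𝔸) - 1‖ ≤ α₁) →
      (∀ m, 1 ≤ m → m < k → ∀ (u₁ : Site d → 𝔸ˣ) (U₁ : Site d → Fin d → 𝔸ˣ) (A : Site d → Fin d → 𝔸),
        (∀ x, u₁ x ∈ unitaryUnits 𝔸) → (∀ x, x ∉ Ω 0 → u₁ x = 1) → mgauge U₀ u₁ U₁ = U' → Restr129 L m (Λs m) U₀ u₁ →
        LanF146 L k η (Ω 0) Λs U₀ φ m U₁ →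
        (∀ j, j ≤ m → ∀ b ∈ {b : Site d × Fin d | SideTouches (Ω j) b.1 b.2},
        U₁ b.1 b.2 = cfgExp η A b.1 b.2 ∧ IsSelfAdjoint (A b.1 b.2) ∧ ‖A b.1 b.2‖ ≤ (5 * (d : ℝ) * L * B₈ * (α₀ + α₁)) * ((L : ℝ) ^ j * η)⁻¹) →
        ∃ (v : Site d → 𝔸ˣ) (lam : Site d → 𝔸), (∀ x, v x ∈ unitaryUnits 𝔸) ∧ (∀ x, x ∉ Ω 0 → v x = 1) ∧
        (∀ j, j ≤ m + 1 → ∀ b ∈ {b : Site d × Fin d | SideTouches (Ω j) b.1 b.2}, (v b.1 : 𝔸) = ((gaugeExp lam b.1 : 𝔸ˣ) : 𝔸) ∧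
        (v (b.1 + e b.2) : 𝔸) = ((gaugeExp lam (b.1 + e b.2) : 𝔸ˣ) : 𝔸)) ∧
        (∀ j, j ≤ m + 1 → ∀ b ∈ {b : Site d × Fin d | SideTouches (Ω j) b.1 b.2},
        ‖lam b.1‖ ≤ (8 * B₀' * (5 * (d : ℝ) * L * B₈) * (α₀ + α₁)) ∧ ((L : ℝ) ^ j * η) * ‖covDerivFwd η U₀ b.2 lam b.1‖ ≤ (8 * B₀' * (5 * (d : ℝ) * L * B₈) * (α₀ + α₁))) ∧
        LanF146 L k η (Ω 0) Λs U₀ φ (m + 1) (mgauge U₀ v⁻¹ U₁) ∧ Restr129 L (m + 1) (Λs (m + 1)) U₀ (u₁ * v)) := by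
  have hL1 : 1 ≤ L := le_trans (by norm_num) hL
  have hd1 : 1 ≤ d := le_trans (by norm_num) hd2
  have hB₈ : 0 < B₈ := lt_of_lt_of_le hB₀ hB₀8
  obtain ⟨cW, hcW, hW⟩ := hfpWindows_of_guard_src hd1 hL1 hB₈ hB₀' hB8two hB₀'H hB₂' hBG hBR hγ hfree
  refine ⟨min cW (min cL c59), lt_min hcW (lt_min hcL hc59), ?_⟩
  have hPW : min cW (min cL c59) ≤ cW := min_le_left _ _
  have hPL : min cW (min cL c59) ≤ cL := (min_le_right _ _).trans (min_le_left _ _)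
  have hP59 : min cW (min cL c59) ≤ c59 := (min_le_right _ _).trans (min_le_right _ _)
  exact sp5_of_sockLettersRD_src hd2 hL hη hΩ hbox hclass htw h8lt h8top hB₀ hB₀' hB₀'H hB₂' hBG hBR hγ hγ' hB₀8 hγB SLet hPL
    (fun α₀ α₁ hα₀ hα₁ hs => SH59 α₀ α₁ hα₀ hα₁ (hs.trans hP59))
    (fun α₀ α₁ hα₀ hα₁ hs cs α₄ cB cDA hE hE₂ lE lE₂ e1 e2 e3 e4 e5 e6 e7 e8 => by
      obtain ⟨w1, w2, w3, w4, w5, w6, w7, w8, w9, w10, w11, w12, w13, w14, w15, w16, w17, w18, w19, w20, w21, w22, w23, w24, w25, w26, w27, -⟩ :=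
        hW α₀ α₁ hα₀ hα₁ (hs.trans hPW) cs α₄ cB cDA hE hE₂ lE lE₂ e1 e2 e3 e4 e5 e6 e7 e8
      exact ⟨w1, w2, w3, w4, w5, w6, w7, w8, w9, w10, w11, w12, w13, w14, w15, w16, w17, w18, w19, w20, w21, w22, w23, w24, w25, w26, w27⟩)

/-- **THE KNIT's SOURCED BASE SOCKET `SP5base` AT ONE MEMBER, BELOW ONE THRESHOLD**: `B8SockSP5BaseSrc.sp5base_of_sockLettersRD_src` with its windows family
discharged by `B8SockWindowsSrc.hfpWindows_of_guard_src` (`c_P := min(c_W, c_L)`; no b9 socket is read at the base).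
[cite: Balaban1985RegularSpaces, Thm 4 p.88 («there exists a constant c₁»), Prop. 5 p.94, p.95 («For j = 0 we apply simply Proposition 5»), Thm 8 (1.146) p.101] -/
theorem exists_threshold_sp5base_src (hd2 : 2 ≤ d) (hL : 2 ≤ L) (hη : 0 < η) (hk : 1 ≤ k) (hΩ : ∀ j, Ω (j + 1) ⊆ Ω j)
    (hfree : 3 * (2 * (d : ℝ) * (L : ℝ) ^ 2) * BG * BR * (B₈ + γ) ≤ B₀' * B₈) (hcL : 0 < cL)
    (htw : ∀ m, m ≤ k → ∀ j, j ≤ m → ∀ y ∈ Λs m j, ∀ x, InBox (tlo L y j) (thi L y j) x → x ∈ Ω j)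
    (hB₀' : 0 < B₀') (hB₀'H : 0 < B₀'H) (hB₂' : 0 ≤ B₂') (hBG : 0 ≤ BG) (hBR : 0 ≤ BR) (hγ : 0 ≤ γ) (hB₈ : 0 < B₈)
    (hB8two : 2 ≤ 5 * (d : ℝ) * L * B₈)
    (SLet : SockLettersRD (𝔸 := 𝔸) L BG BR B₀'H B₂' cL η k Ω Λs) :
    ∃ cP : ℝ, 0 < cP ∧
    ∀ α₀ α₁ : ℝ, 0 < α₀ → 0 < α₁ → α₀ + α₁ ≤ cP →
      ∀ U₀ U' : Site d → Fin d → 𝔸ˣ, (∀ x κ, U₀ x κ ∈ unitaryUnits 𝔸) → (∀ x κ, U' x κ ∈ unitaryUnits 𝔸) →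
      ∀ φ : Site d → 𝔸, ((InR138 L k η (Ω 0) (Λs k) U₀ φ ∧ (∀ x, IsSelfAdjoint (φ x)) ∧ (∀ x, x ∉ Ω 0 → φ x = 0) ∧
          Bdd L k η (-(2 : ℝ)) (fun j (x : Site d) => x ∈ Ω j) φ) ∧
        msup L k η (-(2 : ℝ)) (fun j (x : Site d) => x ∈ Ω j) φ < γ * (α₀ + α₁)) →
      InAk L k η α₀ Ω U₀ → InAk L k η α₀ Ω (mulCfg U' U₀) → (∀ m, m ≤ k → InAx L m (Λs m) U₀ (mulCfg U' U₀)) →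
      (∀ j, j ≤ k → ∀ (z : Site d) (μ : Fin d), (∀ x, InBox (loK L j z) (bondHiK L j z μ) x → x ∈ Ω j) →
        ‖(avgIter L (mulCfg U' U₀) j z μ : 𝔸) - (avgIter L U₀ j z μ : 𝔸)‖ ≤ α₁) →
      (∀ b ∈ {b : Site d × Fin d | SideTouches (Ω 0) b.1 b.2}, ‖((U' b.1 b.2 : 𝔸ˣ) : 𝔸) - 1‖ ≤ α₁) →
      (∃ (v : Site d → 𝔸ˣ) (lam : Site d → 𝔸), (∀ x, v x ∈ unitaryUnits 𝔸) ∧ (∀ x, x ∉ Ω 0 → v x = 1) ∧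
        (∀ j, j ≤ 1 → ∀ b ∈ {b : Site d × Fin d | SideTouches (Ω j) b.1 b.2}, (v b.1 : 𝔸) = ((gaugeExp lam b.1 : 𝔸ˣ) : 𝔸) ∧
        (v (b.1 + e b.2) : 𝔸) = ((gaugeExp lam (b.1 + e b.2) : 𝔸ˣ) : 𝔸)) ∧
        (∀ j, j ≤ 1 → ∀ b ∈ {b : Site d × Fin d | SideTouches (Ω j) b.1 b.2},
        ‖lam b.1‖ ≤ (8 * B₀' * (5 * (d : ℝ) * L * B₈) * (α₀ + α₁)) ∧ ((L : ℝ) ^ j * η) * ‖covDerivFwd η U₀ b.2 lam b.1‖ ≤ (8 * B₀' * (5 * (d : ℝ) * L * B₈) * (α₀ + α₁))) ∧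
        LanF146 L k η (Ω 0) Λs U₀ φ 1 (mgauge U₀ v⁻¹ U') ∧ Restr129 L 1 (Λs 1) U₀ ((1 : Site d → 𝔸ˣ) * v)) := by
  have hL1 : 1 ≤ L := le_trans (by norm_num) hL
  have hd1 : 1 ≤ d := le_trans (by norm_num) hd2
  obtain ⟨cW, hcW, hW⟩ := hfpWindows_of_guard_src hd1 hL1 hB₈ hB₀' hB8two hB₀'H hB₂' hBG hBR hγ hfree
  refine ⟨min cW cL, lt_min hcW hcL, ?_⟩
  exact sp5base_of_sockLettersRD_src hd2 hL hη hk hΩ htw hB₀' hB₀'H hB₂' hBG hBR hγ hB₈ hB8two SLet (min_le_right _ _)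
    (fun α₀ α₁ hα₀ hα₁ hs cs α₄ cB cDA hE hE₂ lE lE₂ e1 e2 e3 e4 e5 e6 e7 e8 => by
      obtain ⟨-, -, -, -, w5, w6, w7, w8, w9, w10, w11, w12, w13, w14, w15, w16, w17, w18, w19, w20, w21, w22, w23, w24, w25, w26, w27, w28⟩ :=
        hW α₀ α₁ hα₀ hα₁ (hs.trans (min_le_left _ _)) cs α₄ cB cDA hE hE₂ lE lE₂ e1 e2 e3 e4 e5 e6 e7 e8
      exact ⟨w5, w6, w7, w8, w9, w10, w11, w12, w13, w14, w15, w16, w17, w18, w19, w20, w21, w22, w23, w24, w25, w26, w27, w28⟩)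

/-- **THE KNIT's SOURCED UNIQUENESS SOCKET `SP5u` (E CURRENCY) AT ONE `Ω 0 = univ` MEMBER, AT ONE RADIUS, BELOW ONE THRESHOLD** (print's «c₂, c₃»):
`B8SockSP5uProviderSrc.sp5uE_of_lettersUB_src` with its windows family discharged by `B8SockWindowsSrc.uniqWindows_of_guard_src`
(`c_u` and `α₄` from the windows lemma, `c_P := min(c_W, c_L, c₅₉)`).
[cite: Balaban1985RegularSpaces, Prop. 5 (1.109) p.94 («c₂, c₃»; «unique in the domain |λ|, |Dλ|₍₋₁₎ < c₃»), Thm 4 p.88 («exactly one»), Thm 8 (1.146) p.101] -/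
theorem exists_threshold_sp5u_src (hd2 : 2 ≤ d) (hL : 2 ≤ L) (hη : 0 < η) (hk : 1 ≤ k) (hΩ : ∀ j, Ω (j + 1) ⊆ Ω j) (hΩ0 : Ω 0 = Set.univ)
    (hB8two : 2 ≤ 5 * (d : ℝ) * L * B₈) (hcL : 0 < cL)
    (hbox : ∀ m, m ≤ k → ∀ j, j ≤ m → ∀ c ∈ Λb m j, ∀ x, InBox (loK L j c.1) (bondHiK L j c.1 c.2) x → x ∈ Ω j)
    (hclass : ∀ m, m ≤ k → ∀ j, j ≤ m → ∀ c ∈ Λb m j,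
      (c.1 ∈ Λs m j ∧ c.1 + e c.2 ∈ Λs m j) ∨
      (∃ j', j = j' + 1 ∧ (∀ x, (L : ℤ) • c.1 ≤ x → x ≤ (L : ℤ) • c.1 + blockTop L → x ∈ Λs m j') ∧ c.1 + e c.2 ∈ Λs m j) ∨
      (∃ j', j = j' + 1 ∧ c.1 ∈ Λs m j ∧ (∀ x, (L : ℤ) • (c.1 + e c.2) ≤ x → x ≤ (L : ℤ) • (c.1 + e c.2) + blockTop L → x ∈ Λs m j')))
    (htower : ∀ j, j ≤ k → ∀ y ∈ Λs k j, ∀ x, InBox (tlo L y j) (thi L y j) x → x ∈ Ω j)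
    (hB₀ : 0 < B₀) (hB₀' : 0 < B₀') (hB₀'H : 0 < B₀'H) (hB₂' : 0 ≤ B₂') (hBG : 0 ≤ BG) (hBR : 0 ≤ BR) (hγ : 0 ≤ γ) (hγ' : 0 ≤ γ')
    (hB₀8 : B₀ ≤ B₈) (hγB : 2 * (γ' * B₀) ≤ 5 * (d : ℝ) * L * B₈)
    -- (i) [4]'s uniqueness letters at the top structure `(k, Λs k, U₀)`, left-inverse law of `G′` on bounded functions
    (SLetUB : ∀ α₀ : ℝ, 0 < α₀ → α₀ ≤ cL → ∀ U₀ : Site d → Fin d → 𝔸ˣ, (∀ x κ, U₀ x κ ∈ unitaryUnits 𝔸) → InAk L k η α₀ Ω U₀ →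
      ∃ (g Δ : (Site d → 𝔸) →ₗ[ℂ] (Site d → 𝔸)) (q : (Site d → 𝔸) →ₗ[ℂ] (ℕ → Site d → 𝔸)) (qs : (ℕ → Site d → 𝔸) →ₗ[ℂ] (Site d → 𝔸))
        (Aw c : (ℕ → Site d → 𝔸) →ₗ[ℂ] (ℕ → Site d → 𝔸)) (H' : XSpace d k 𝔸 →ₗ[ℂ] (Site d → 𝔸)),
        (∀ x : Site d → 𝔸, (∃ C : ℝ, ∀ y, ‖x y‖ ≤ C) → g (Δ x + qs (Aw (q x))) = x) ∧ (∀ φ, qs (c (q (g (g (qs φ))))) = qs φ) ∧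
        (∀ (f : Site d → 𝔸), ∀ x ∈ Ω 0, Δ f x = covLap η U₀ ((Ω 0).indicator f) x) ∧
        (∀ (μ : ℕ → Site d → 𝔸), ∀ x ∈ Ω 0, qs μ x = QT L k (Λs k) U₀ μ x) ∧
        (∀ (f : Site d → 𝔸) (j : ℕ), j ≤ k → ∀ y ∈ Λs k j, q f j y = QprimeIter (zdBlocking d L) (bgT L U₀) j f y) ∧
        (∀ (f : Site d → 𝔸) (j : ℕ) (y : Site d), ¬ (j ≤ k ∧ y ∈ Λs k j) → q f j y = 0) ∧
        (∀ (X : XSpace d k 𝔸) (x : Site d), ‖H' X x‖ ≤ B₀'H * ‖X‖) ∧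
        (∀ j, j ≤ k → ∀ (X : XSpace d k 𝔸), ∀ p ∈ {b : Site d × Fin d | SideTouches (Ω j) b.1 b.2},
          wt L η j * ‖covDerivFwd η U₀ p.2 (H' X) p.1‖ ≤ B₀'H * ‖X‖) ∧
        (∀ X : XSpace d k 𝔸, Bd2 L η k Ω (covLap η U₀ (H' X)) (B₂' * ‖X‖)) ∧
        (∀ (Y : XSpace d k 𝔸) (j : ℕ) (hj : j ≤ k) (y : Site d), y ∈ Λs k j →
          QprimeIter (zdBlocking d L) (bgT L U₀) j (H' Y) y = Y (⟨j, Nat.lt_succ_of_le hj⟩, y)) ∧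
        (∀ (f : Site d → 𝔸) (r : ℝ), 0 ≤ r → Bd2 L η k Ω f r →
          (∀ x, ‖g f x‖ ≤ BG * r) ∧ ∀ j, j ≤ k → ∀ p ∈ {b : Site d × Fin d | SideTouches (Ω j) b.1 b.2},
            wt L η j * ‖covDerivFwd η U₀ p.2 (g f) p.1‖ ≤ BG * r) ∧
        (∀ (f : Site d → 𝔸) (r : ℝ), 0 ≤ r → Bd2 L η k Ω f r → Bd2 L η k Ω (f - g (qs (c (q (g f))))) (BR * r)))
    -- (ii) THE SOURCED b9 SOCKET AT THIS MEMBER (the knit's `SH59src` at `LanF := LanF146`)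
    {c59 : ℝ} (hc59 : 0 < c59)
    (SH59 : ∀ α₀ α₁ : ℝ, 0 < α₀ → 0 < α₁ → α₀ + α₁ ≤ c59 →
      ∀ U₀ U' : Site d → Fin d → 𝔸ˣ, (∀ x κ, U₀ x κ ∈ unitaryUnits 𝔸) → (∀ x κ, U' x κ ∈ unitaryUnits 𝔸) →
      ∀ φ : Site d → 𝔸, ((InR138 L k η (Ω 0) (Λs k) U₀ φ ∧ (∀ x, IsSelfAdjoint (φ x)) ∧ (∀ x, x ∉ Ω 0 → φ x = 0) ∧
          Bdd L k η (-(2 : ℝ)) (fun j (x : Site d) => x ∈ Ω j) φ) ∧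
        msup L k η (-(2 : ℝ)) (fun j (x : Site d) => x ∈ Ω j) φ < γ * (α₀ + α₁)) →
      InAk L k η α₀ Ω U₀ → InAk L k η α₀ Ω (mulCfg U' U₀) → (∀ m, m ≤ k → InAx L m (Λs m) U₀ (mulCfg U' U₀)) →
      (∀ j, j ≤ k → ∀ (z : Site d) (μ : Fin d), (∀ x, InBox (loK L j z) (bondHiK L j z μ) x → x ∈ Ω j) →
        ‖(avgIter L (mulCfg U' U₀) j z μ : 𝔸) - (avgIter L U₀ j z μ : 𝔸)‖ ≤ α₁) →
      (∀ b ∈ {b : Site d × Fin d | SideTouches (Ω 0) b.1 b.2}, ‖((U' b.1 b.2 : 𝔸ˣ) : 𝔸) - 1‖ ≤ α₁) →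
      (∀ m, 1 ≤ m → m ≤ k → ∀ (u : Site d → 𝔸ˣ) (W : Site d → Fin d → 𝔸ˣ) (A' : Site d → Fin d → 𝔸),
        (∀ x, u x ∈ unitaryUnits 𝔸) → mgauge U₀ u W = U' → Restr129 L m (Λs m) U₀ u → LanF146 L k η (Ω 0) Λs U₀ φ m W →
        (∀ y τ, IsSelfAdjoint (A' y τ)) →
        (∀ j, j ≤ m → ∀ y τ, SideTouches (Ω j) y τ →
        W y τ = cfgExp η A' y τ ∧ ‖A' y τ‖ ≤ (2 * (L * (5 * (d : ℝ) * L * B₈ * (α₀ + α₁))) + 8 * (8 * B₀' * (5 * (d : ℝ) * L * B₈) * (α₀ + α₁))) * ((L : ℝ) ^ j * η)⁻¹) →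
        (∀ y τ, (∀ j, j ≤ m → ¬ SideTouches (Ω j) y τ) → A' y τ = 0) →
        msup L m η (-(1 : ℝ)) (fun j (b : Site d × Fin d) => SideTouches (Ω j) b.1 b.2) (fun b => A' b.1 b.2)
        ≤ B₀ * (bondNorm L m η (-(3 : ℝ)) Ω (fun x μ => Jcur η U₀ A' μ x)
        + wsup 1 (fun p : {p : ℕ × (Site d × Fin d) // p.1 ≤ m ∧ p.2 ∈ Λb m p.1} =>
        linCovIter L U₀ (iEta η A') p.1.1 p.1.2.1 p.1.2.2)) + γ' * B₀ * (α₀ + α₁) ∧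
        msup L m η (-(2 : ℝ)) (fun j (t : Fin d × Fin d × Site d) => SideTouches (Ω j) t.2.2 t.2.1)
        (fun t => covDerivFwd η U₀ t.1 (fun z => A' z t.2.1) t.2.2)
        ≤ B₀ * (bondNorm L m η (-(3 : ℝ)) Ω (fun x μ => Jcur η U₀ A' μ x)
        + wsup 1 (fun p : {p : ℕ × (Site d × Fin d) // p.1 ≤ m ∧ p.2 ∈ Λb m p.1} =>
        linCovIter L U₀ (iEta η A') p.1.1 p.1.2.1 p.1.2.2)) + γ' * B₀ * (α₀ + α₁))) :
    ∃ cu cP : ℝ, 0 < cu ∧ 0 < cP ∧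
    -- THE ρ3 `SP5u` BINDER BODY AT THIS MEMBER (`SockP5uE L B₈ cP cu η k Ω Λs` with `IsLandau138W ↦ LanF146 … φ k`, source binder after `hU'`)
    ∀ α₀ α₁ : ℝ, 0 < α₀ → 0 < α₁ → α₀ + α₁ ≤ cP →
      ∀ U₀ U' : Site d → Fin d → 𝔸ˣ, (∀ x κ, U₀ x κ ∈ unitaryUnits 𝔸) → (∀ x κ, U' x κ ∈ unitaryUnits 𝔸) →
      ∀ φ : Site d → 𝔸, ((InR138 L k η (Ω 0) (Λs k) U₀ φ ∧ (∀ x, IsSelfAdjoint (φ x)) ∧ (∀ x, x ∉ Ω 0 → φ x = 0) ∧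
          Bdd L k η (-(2 : ℝ)) (fun j (x : Site d) => x ∈ Ω j) φ) ∧
        msup L k η (-(2 : ℝ)) (fun j (x : Site d) => x ∈ Ω j) φ < γ * (α₀ + α₁)) →
      InAk L k η α₀ Ω U₀ → InAk L k η α₀ Ω (mulCfg U' U₀) → (∀ m, m ≤ k → InAx L m (Λs m) U₀ (mulCfg U' U₀)) →
      (∀ j, j ≤ k → ∀ (z : Site d) (μ : Fin d), (∀ x, InBox (loK L j z) (bondHiK L j z μ) x → x ∈ Ω j) →
        ‖(avgIter L (mulCfg U' U₀) j z μ : 𝔸) - (avgIter L U₀ j z μ : 𝔸)‖ ≤ α₁) →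
      (∀ b ∈ {b : Site d × Fin d | SideTouches (Ω 0) b.1 b.2}, ‖((U' b.1 b.2 : 𝔸ˣ) : 𝔸) - 1‖ ≤ α₁) →
      ∀ u₁ : Site d → 𝔸ˣ, (∀ x, u₁ x ∈ unitaryUnits 𝔸) → (∀ x, x ∉ Ω 0 → u₁ x = 1) → Restr129 L k (Λs k) U₀ u₁ →
      LanF146 L k η (Ω 0) Λs U₀ φ k (mgauge U₀ u₁⁻¹ U') →
      (∃ A₁ : Site d → Fin d → 𝔸, ∀ j, j ≤ k → ∀ (x : Site d) (κ : Fin d), SideTouches (Ω j) x κ →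
        mgauge U₀ u₁⁻¹ U' x κ = cfgExp η A₁ x κ ∧ ‖A₁ x κ‖ ≤ (5 * (d : ℝ) * L * B₈ * (α₀ + α₁)) * ((L : ℝ) ^ j * η)⁻¹) →
      ∀ (v w : Site d → 𝔸ˣ) (lam mu : Site d → 𝔸),
      (∀ x, ((gaugeExp lam x : 𝔸ˣ) : 𝔸) = ((v x : 𝔸ˣ) : 𝔸) ∧ IsSelfAdjoint (lam x) ∧ ‖lam x‖ < cu) → (∀ x, x ∉ Ω 0 → lam x = 0) →
      (∀ j, j ≤ k → ∀ b ∈ {b : Site d × Fin d | SideTouches (Ω j) b.1 b.2}, ((L : ℝ) ^ j * η) * ‖covDerivFwd η U₀ b.2 lam b.1‖ < cu) →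
      (∀ x, ((gaugeExp mu x : 𝔸ˣ) : 𝔸) = ((w x : 𝔸ˣ) : 𝔸) ∧ IsSelfAdjoint (mu x) ∧ ‖mu x‖ < cu) → (∀ x, x ∉ Ω 0 → mu x = 0) →
      (∀ j, j ≤ k → ∀ b ∈ {b : Site d × Fin d | SideTouches (Ω j) b.1 b.2}, ((L : ℝ) ^ j * η) * ‖covDerivFwd η U₀ b.2 mu b.1‖ < cu) →
      LanF146 L k η (Ω 0) Λs U₀ φ k (mgauge U₀ v⁻¹ (mgauge U₀ u₁⁻¹ U')) → Restr129 L k (Λs k) U₀ (u₁ * v) →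
      LanF146 L k η (Ω 0) Λs U₀ φ k (mgauge U₀ w⁻¹ (mgauge U₀ u₁⁻¹ U')) → Restr129 L k (Λs k) U₀ (u₁ * w) →
      ∀ x, v x = w x := by
  have hL1 : 1 ≤ L := le_trans (by norm_num) hL
  have hd1 : 1 ≤ d := le_trans (by norm_num) hd2
  have hB₈ : 0 < B₈ := lt_of_lt_of_le hB₀ hB₀8
  obtain ⟨α₄, cu, cW, hα₄, hcu, hcW, hW⟩ := uniqWindows_of_guard_src hd1 hL1 hB₈ hB8two hB₀'H hB₂' hBG hBR hγ
  refine ⟨cu, min cW (min cL c59), hcu, lt_min hcW (lt_min hcL hc59), ?_⟩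
  have hPW : min cW (min cL c59) ≤ cW := min_le_left _ _
  have hPL : min cW (min cL c59) ≤ cL := (min_le_right _ _).trans (min_le_left _ _)
  have hP59 : min cW (min cL c59) ≤ c59 := (min_le_right _ _).trans (min_le_right _ _)
  exact sp5uE_of_lettersUB_src hd2 hL hη hk hΩ hΩ0 hbox hclass htower hB₀ hB₀' hB₀'H hB₂' hBG hBR hγ hγ' hB₀8 hγB hα₄ SLetUB hPL
    (fun α₀ α₁ hα₀ hα₁ hs => SH59 α₀ α₁ hα₀ hα₁ (hs.trans hP59))
    (fun α₀ α₁ hα₀ hα₁ hs => hW α₀ α₁ hα₀ hα₁ (hs.trans hPW))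

end Literature.MathematicalPhysics.QuantumFieldTheory.Balaban1983to89.B8SockSP5ThresholdsSrc

end
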